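import Mathlib
import HarnessLib
import HarnessLib.Audit
import Summits.ValiantsHypothesis.Statement
import Literature.Computability.AlgebraicComplexity.DeterminantalComplexity
import Literature.Computability.AlgebraicComplexity.EquivariantDC
import Literature.Computability.AlgebraicComplexity.ValiantConjectureProofs
import Literature.Computability.AlgebraicComplexity.VPDeterminantalQPProofs
import HarnessLib.Audit.Status.Attr

/-!
Route: RigidMinimalReps

DORMANT since 2026-08-24T11:38:27Z (reconciler: no traction for 6.7 d (last activity item-evidence-added at 2026-08-17T17:09:06Z); parked, not closed — `ledger route dormant route-ValiantsHypothesis-RigidMinimalReps --off` to reactivate) — unstaffed, not closed; items shared with open routes are served there. `ledger route dormant <id> --off` reactivates.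

# Route RigidMinimalReps — doubly-minimal determinantal representations of per_n are rigid, hence
torus-symmetric, hence of Grenet size

It suffices to show X = "THE OPTIMUM IS TORUS-SYMMETRIC": for all large n, per_n has an affine
determinantal representation of size
exactly dc(per_n) admitting exact lifts (LR17 Def. 1.3, tree form `IsEquivariantDetRepr`) of the
whole connected symmetry torus
x_{kl} ↦ d_k e_l x_{kl} (row and column scalings), i.e. edc_T(per_n) = dc(per_n). Realises card
rigid-minimal-detreps-inherit-symmetry
("optimal ⇒ canonical ⇒ symmetric") in REPAIRED form: the card's finiteness-modulo-gauge hypothesis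
R1 is false as stated already at
n = 3 (computed in this unit, see Cheapest falsifier) and is replaced by finiteness of gauge orbits
on the DOUBLY-MINIMAL locus (minimal
size, then minimal total coefficient rank), which passes the same test; the card's permutation
cruxes R2/R3 (small-index subgroups,
LR17 Thm 2.8 for A_n) are made unnecessary by the two-sided TorusBound, so only the connected part
of G_per is used and the group theory
collapses to divisibility of (ℂ*)^{2n}. X with TorusBound gives dc(per_n) ≥ 2^n − 1 (Grenet optimal)
for large n, hence VH.
Lean: `∃ n₀ : ℕ, ∀ n ≥ n₀, Literature.Computability.AlgebraicComplexity.HasEquivariantDetRepr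
(Subgroup.closure {γ : Matrix.GeneralLinearGroup (Fin n × Fin n) ℂ | ∃ d e : Fin n → ℂ, (∀ i, d i ≠
0) ∧ (∀ j, e j ≠ 0) ∧ (γ : Matrix (Fin n × Fin n) (Fin n × Fin n) ℂ) = Matrix.diagonal (fun p => d
p.1 * e p.2)}) (Literature.Computability.AlgebraicComplexity.perPoly (Fin n) ℂ)
(Literature.Computability.AlgebraicComplexity.determinantalComplexity
(Literature.Computability.AlgebraicComplexity.perPoly (Fin n) ℂ))`

## Assembly
X gives, for n ≥ max(n₀,3), a representation A of size dc(per_n) with exact two-sided torus lifts;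
TorusBound gives dc(per_n) = size(A) ≥ 2^n − 1 ≥ (3/2)^n;
ExpDcGlue (VP ⇒ quasi-polynomially bounded dc, per ∈ VNP, hub lemma — all proved in the cone) turns
the eventual exponential bound into
VP ℂ ≠ VNP ℂ. Layer 1 feeding X: DoublyMinimalFinite → (OrbitsForceTorus) → X. Pure logic plus the
in-tree facts named in ExpDcGlue; no
unproved Literature fact is a hypothesis anywhere in the route.

Rationale: WHY THIS LINE. Landsberg–Ressayre ask (LandsbergRessayre2017 §2.1, after Q2.2) "when an object has
symmetry, does it admit an optimal expression that
preserves its symmetry?" and prove exponential bounds once HALF the symmetry (left torus ⋊ S_m) is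
imposed (Thm 2.8, proved in tree:
`lr_left_equivariant_lower_holds`). This line supplies a MECHANISM for the connected half: on R_n =
{affine A of size dc(per_n) : det A = per_n}
the gauge group GL_s × GL_s (A ↦ PAQ, connected) and the torus T = T^E × T^F of G_per act and
commute; if a T-stable, gauge-stable stratum
of R_n (here: the minimisers of the upper-semicontinuous invariant Σ_{kl} rank A_{kl}) is a FINITE
union of gauge orbits, T permutes them,
and a divisible group has no finite-index subgroups, so every such orbit is T-fixed — which is
verbatim the exact-lift property. The lower
bound then needs NO Weyl group: regularity (vonzurGathen1987 Thm 3.1, in tree) plus a two-sided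
torus grading turns the representation into
a (rows-used, columns-used)-graded branching program whose level-(S,T) vertices serve only the
d!(n−d)! permutations with σ(S) = T, forcing
≥ C(n,d) vertices per level and size ≥ 2^n − 1 (Grenet2011 is then optimal; consistent with
dc(per_3) = 7, AlperBogartVelasco2017, and with
HuttenhainIkenmeyer2016 Prop 9: all 463 binary 7×7 representations of per_3 are gauge-equivalent to
Grenet's). Imported areas: deformation
theory / transformation groups (orbit stratifications, Zariski tangent spaces — already used here as
a certified computation) and the
combinatorics of graded ABPs; nothing from rank/flattening measures. Versus route DetQP (crux
DetqpSymmetrization: "symmetrise at qp cost",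
no mechanism, S_m needed) this line derives symmetry instead of paying for it, needs only the torus,
and lands on 2^n − 1 exactly; the
determinant escapes the same argument only through IRREGULAR representations (edc_T(det_m) = m,
IkenmeyerLandsberg2017 p.3), which per_n
(n ≥ 3) does not have.

RANKED CRUXES. #0 MinimalRepTorusSymmetric (target) — X: for all large n, per_n has an affine
determinantal representation of size dc(per_n) with exact GL×GL-lifts of every two-sided torus
substitution x_{kl} ↦ d_k e_l x_{kl} (edc_T(per_n) = dc(per_n)). (why it might fail: By the
Białynicki-Birula criterion (retired card torus-symmetrisation-is-homogenisation, part 1) X fails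
iff EVERY optimal representation has essential top-weight cancellation for some 1-PS; with
TorusBound, any rep of per_n of size < 2^n−1 for infinitely many n refutes X.)
[LandsbergRessayre2017, Grenet2011, AlperBogartVelasco2017, IkenmeyerLandsberg2017]
#2 DoublyMinimalFinite (crux) — (card R1, repaired) For all large n, at s = dc(per_n): the affine
determinantal representations A of per_n of size s that minimise the total coefficient rank Σ_{kl}
rank(A_{kl}) are covered by finitely many GL_s × GL_s-orbits A = P·F_i·Q (constant invertible P, Q).
[difficulty: XL] (why it might fail: Plain size-minimal finiteness is FALSE (n=3: exact Koszul lines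
row_0 += ε(x_33·row_5 − x_32·row_4) through Grenet, 45 non-gauge tangent dims); rank-minimisation
kills them to 1st order at n=3 only; other affine-preserving polynomial gauge moves or inequivalent
optimal ABPs may persist.) [HuttenhainIkenmeyer2016, AlperBogartVelasco2017, LandsbergRessayre2017,
arXiv:2003.04834]
#3 TorusBound (crux) — For n ≥ 3, every affine determinantal representation of per_n with exact
lifts of the two-sided torus has size ≥ 2^n − 1 (regularity ⇒ Λ = 0 ⊕ I; generalized eigenspaces of
one generic lifted element (distinct primes) grade rows/columns; matched digraph acyclic;
(S,T)-graded ABP; each level-(S,T) vertex serves only σ with σ(S)=T ⇒ ≥ C(n,d) vertices at depth d).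
[difficulty: L] (why it might fail: LR17 Thm 2.8's count uses S_m (k-homogeneity) essentially and no
torus-only bound is in print; ONE-sided torus gives only an unordered row-multilinear ABP (bound
~n); the two-sided count needs "levels are sets / no junk paths", resting on regularity (fails at
n=2: dc(per_2)=2<3).) [LandsbergRessayre2017, vonzurGathen1987, Grenet2011, IkenmeyerLandsberg2017]
#9 OrbitsForceTorus (support) — DoublyMinimalFinite → MinimalRepTorusSymmetric: T acts on
doubly-minimal reps by (t⋆A)(x) = D_t·A(t·x) with D_t = diag((Πd Πe)⁻¹,1,…,1), commuting with the
gauge action; it permutes the finitely many orbits; (ℂ*)^{2n} is divisible so each orbit's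
stabiliser (finite index) is all of T; t⋆A = PAQ is exactly an exact lift. Doubly-minimal reps exist
(well-ordering on ℕ, `hasDetRepr_determinantalComplexity_holds`). [difficulty: provable-now]
[LandsbergRessayre2017, Borel1991]
#9 ExpDcGlue (support) — an eventual exponential lower bound c^n ≤ dc(per_n) (c > 1) implies VH: VP
= VNP ⇒ per ∈ VP (perFamily_mem_VNP_holds, mem_VP_ofFintype_iff_holds) ⇒ dc(per_n) ≤ 2^((log n +
a)^a) (isQPBounded_determinantalComplexity_of_isVPFamily_holds) = o(c^n), contradiction; all
ingredients proved in tree (Hub: Theorems/HubHub.lean). The hypothesis is verbatim route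
GrenetRigidity's target DcPerExponential, so this item = GrenetRigidity.Assembly unfolded: prove
once, `exact` twice. [difficulty: provable-now] [Burgisser2000, Valiant1979, LandsbergRessayre2017]

TWO-LAYER PLAN. Foreseen splits, none filed now. (a) TorusBound ⇐ TbRegularGraded → TbCovering →
TorusBound: TbRegularGraded = "a two-sided-torus-equivariant
regular representation is gauge-equivalent to Λ = 0 ⊕ I with every row/column a generalized weight
vector and the matched digraph acyclic"
(reuse LandsbergRessayreNormalForm / GenericTorusGrading / LRPencilOfMatrix), TbCovering = "an
(S,T)-graded ABP computing a polynomial whose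
support contains all permutation monomials has ≥ C(n,d) vertices at depth d". (b)
DoublyMinimalFinite ⇐ LocalRigidity → OrbitCount → DoublyMinimalFinite:
LocalRigidity = "at every doubly-minimal A the Zariski tangent space of the rank-constrained variety
equals the gauge tangent" (openness of
orbits), OrbitCount = quasi-compactness bookkeeping. (c) If DoublyMinimalFinite dies but some weaker
T-stable finite stratification survives
(closed orbits of minimal dimension; BB-sinks), restate rank 2 over that stratum — OrbitsForceTorus
is insensitive to which invariant is minimised.

KILL CRITERIA. Refutation of TorusBound (a two-sided-torus-equivariant representation of per_n, n ≥
3, of size < 2^n − 1; first candidates n = 4, sizes 9–14)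
closes the route outright (refuted:TorusBound) and retires the whole "symmetry for free" family's
engine. Refutation of DoublyMinimalFinite by a
positive-dimensional family of pairwise gauge-inequivalent doubly-minimal representations (already
testable at n = 3: second-order/global
structure of R' = R(per_3,7) ∩ {Σ rank A_kl ≤ 12}) forces the pivot (c) of the two-layer plan or
closure if no finite T-stable stratum is left.
A proof elsewhere of dc(per_n) < 2^n − 1 for infinitely many n refutes X (target) given TorusBound.
DetQP's DetqpSymmetrization proved ⇒ this
route is mooted as a path to VH (but X and TorusBound keep independent value: Grenet optimality).

NOT DECOMPOSED YET. No normal-form lemma for doubly-minimal representations, no explicit orbit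
count, no n₀; the (S,T)-graded ABP notion is not requested as a
definition until a prover of TorusBound asks (the in-tree TorusData/canonical-subspace framework may
suffice); the permutation half of G_per
(card items R2/R3: small-index subgroups of S_n, LR17 Thm 2.8 for T ⋊ A_n and Young subgroups) is
deliberately dropped — it returns only as a
separate route if TorusBound fails; no negative-side items (¬DoublyMinimalFinite at fixed n is a kit
computation, not a statement worth staffing).

CHEAPEST FALSIFIER. The n = 3 tangent-space test named by the card and triage-6/7 — RUN in this unit
(pure python, exact mod two primes, kit/grenet3_tangent{,2,3}.py,
< 1 s each): R = {affine 7×7 A : det A = per_3} at Grenet's A_G: dim T_A R = 141 vs gauge tangent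
{PA_G − A_G Q : tr P = tr Q} = 96
(stabiliser = scalars); 105/141 tangent basis vectors span EXACT LINES in R, e.g. row_0 += ε(x_33
row_5 − x_32 row_4) (unimodular polynomial
row operation keeping affineness), not tangent to the orbit; every orbit in R has dim ≤ 96, so A_G
lies in no orbit-closure boundary and
R(per_3,7) is NOT a finite union of GL_7×GL_7-orbits: the card's R1 is dead as stated. Adding
rank(A_kl) ≤ rank((A_G)_kl) for all kl
(292 linear conditions) the tangent space drops to EXACTLY 96 = gauge: Grenet is infinitesimally
rigid among rank-profile-minimal reps —
hence the doubly-minimal form of rank 2. Next cheapest: (i) is Σ rank = 12 minimal among size-7 reps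
of per_3? (ii) TorusBound at n = 4:
search (S,T)-graded ABPs / two-sided-torus-equivariant reps of per_4 of size ≤ 14 — a finite
combinatorial search.

NUMBERS. dc(per_3) = 7 = 2^3 − 1 (AlperBogartVelasco2017); n²/2 ≤ dc(per_n) ≤ 2^n − 1
(MignonRessayre2004, Grenet2011); edc for left monomial symmetry
≥ 2^m − 1 (LandsbergRessayre2017 Thm 2.8, in tree), full symmetry = C(2m,m) − 1 (Thm 2.1);
edc_T(det_m) = m (IkenmeyerLandsberg2017 p.3;
irregular); rdc(det_m) = O(m³) (IkenmeyerLandsberg2017). This unit: dim T_{Grenet} R(per_3,7) = 141,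
gauge 96, rank-constrained 96; 463 binary
7×7 reps of per_3, one gauge class (HuttenhainIkenmeyer2016 Prop 9).

DEFINITION REQUESTS. None blocking. Hygiene (optional, for a grounder): a named subgroup
`twoSidedTorusSubst k n ≤ GL (Fin n × Fin n) k` next to
`leftMonomialSubst` in Literature/Computability/AlgebraicComplexity/LandsbergRessayre.lean would let
the three items above be re-typed over a
named constant (meaning unchanged; the inline closure is the same set).

Novelty: Searches (2026-08-15): `lit search --hybrid "determinantal representation permanent Grenet
uniqueness rigidity moduli"` (12 book hits, none on
point beyond Landsberg2017 ch. 6–7); `lit search --source zbmath "determinantal complexity permanent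
symmetry"` (2: LR17 journal + conference);
`lit search --source zbmath "rigidity determinantal representation hypersurface moduli torus
equivariant"` (0); OpenAlex/arXiv rate-limited (429);
`lit galaxy search "determinantal representations of the permanent" --star all` (galaxyd saturated
twice, crabby 0 hits); `lit frontier
ValiantsHypothesis --since 2020` (30 rows; dc-related only doi:10.1007/s00224-025-10253-8,
arXiv:2606.11090, arXiv:2606.13628 — bounds, not
rigidity); `lit read arxiv:1508.05788` (Q2.2, Q2.7, Thm 2.8, §2.1 question on optimal symmetric
expressions), `lit read arxiv:1410.8202` (§4, Prop 9).
Nearest prior art found: LandsbergRessayre2017 (arXiv:1508.05788) Thm 2.8 / Q2.2 / Q2.7 — symmetry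
is a HYPOTHESIS there, Weyl group needed;
HuttenhainIkenmeyer2016 (arXiv:1410.8202) Prop 9 — uniqueness of Grenet among binary 7×7 reps
(evidence, no mechanism); in-tree cards
rigidity-implies-grenet (isolated orbit ⇒ torus symmetry; TorusBound sketched by triage-7) and
grenet-stability-bootstrap (uniqueness ⇒ bootstrap).
Delta: first statement deriving LR-equivariance of OPTIMAL representations from a
finiteness/rigidity property, with (i) the computed fact that
plain finiteness fails at n = 3 and the rank-profile repair that restore  [refs: 10.1007/s00224-025-10253-8, 2606.11090, 2606.13628, 1508.05788, 1410.8202, doi:10.1007/s00224-025-10253-8, arxiv:1508.05788, arxiv:1410.8202, Landsberg2017, LandsbergRessayre2017, HuttenhainIkenmeyer2016]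

Barriers (technique_class: deformation-rigidity, equivariant-dc): - technique_class: deformation-rigidity, equivariant-dc
- Literature.Barriers.ValiantsHypothesis.PermanentCharTwo: respected and explanatory — over char 2
per_n = det_n has the size-n IRREGULAR torus-equivariant representation, so TorusBound must and does
use regularity (vzG87, char 0, n ≥ 3); all statements are over ℂ.
- Literature.Barriers.ValiantsHypothesis.RankMethods: not engaged — no rank/flattening measure
certifies the bound; Σ rank A_kl enters only to SELECT a stratum of representations, and the lower
bound is a covering count valid inside the graded model, transferred by rigidity, not by a measure.
- Literature.Barriers.ValiantsHypothesis.PartialDerivativesDetPerm: not engaged (no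
partial-derivative dimension counts; det and per are separated by regularity of minimal
representations, a property the two polynomials provably do not share).
- Literature.Barriers.ValiantsHypothesis.MonotoneGap: the covering count is a support argument but
applied only to (S,T)-GRADED programs with arbitrary signs, where cancellation cannot create support
on permutation monomials; the transfer to general representations is "rigid ⇒ graded", not "monotone
⇒ general"; it does not evade the barrier by force — the bet is DoublyMinimalFinite.
- Literature.Barriers.ValiantsHypothesis.AlgebraicNaturalProofs: not engaged — rigidity of one
solution variety is not a distinguisher on coefficient space (conditional barrier anyway).
- Literature.Barriers.ValiantsHypothesis.GCTOccurrenceObstructions: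

Novelty grade: variant — ROUTE REVIEW (refuter 2026-08-15). 6/6 decls elaborate (W_val.lean rc0); 0 refuted, 0 vacuous, 0 trivial; per-item stamps with briefings on 5112/5113/5115/5116/5117. OBJECTION (dedup): crux TorusBound stmt-5114 is the SAME statement as stmt-4164 of the open sibling RigidityForcesSymmetry — TorusBoun (refuter refuter-rreview-route-AtomisticToContinu-40e6b8ec-0, 2026-08-15T14:06:37Z; prior: route-ValiantsHypothesis-RigidityForcesSymmetry (OPEN sibling: rigidity => exact full-torus lifts => TorusBound => Grenet size; its TorusBound stmt-4164 == this route's stmt-5114, proved iff), LandsbergRessayre2017 arXiv:1508.05788 Thm 2.8 + section 2.1 question after Q2.2 (read p.6, pp.12-14: printed 2^m-1 proofs use N(T) with S_m / SL(E)-irreducibility + Pieri; torus-only bound not in print), Hu)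

History (route lifecycle, newest last):
- 2026-08-16T04:21:46Z · AUTO-CRUX (backfill): MinimalRepTorusSymmetric — hypotheses of the deciding theorem that nothing in the route derives are cruxes (operator:999:1085951)
- 2026-08-24T11:38:27Z · DORMANT — reconciler: no traction for 6.7 d (last activity item-evidence-added at 2026-08-17T17:09:06Z); parked, not closed — `ledger route dormant route-ValiantsHypothes (operator:999:3004356)

sub-problem: ValiantsHypothesis · status: dormant · opened planner-plancard-ValiantsHypothesis-ValiantsH-5cf85143-0 2026-08-15T11:40:00Z · rev 1 · ledger route-ValiantsHypothesis-RigidMinimalReps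
GENERATED by the gate from the ledger (D-0016/17). Provers cite these decls: `theorem foo : Summit.ValiantsHypothesis.ValiantsHypothesis.Theses.RigidMinimalReps.<Decl> := …` in Summits/ValiantsHypothesis/ValiantsHypothesis/Theorems/<Name>.lean.
-/

namespace Summit.ValiantsHypothesis.ValiantsHypothesis.Theses.RigidMinimalReps

open scoped BigOperators Topology Manifold Classical MeasureTheory ProbabilityTheory Matrix InnerProductSpace ComplexConjugate ContinuousMap
open Filter Set Function TopologicalSpace MeasureTheory

attribute [summit_statement] _root_.ValiantsHypothesis

open Literature.PNP

/-- item stmt-ValiantsHypothesis-5112 · crux (kind.auto-crux: conjecture-grade) · rank 0 · open · by planner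
why it might fail: By the Białynicki-Birula criterion (retired card torus-symmetrisation-is-homogenisation, part 1) X fails iff EVERY optimal representation has essential top-weight cancellation for some 1-PS; with TorusBound, any rep of per_n of size < 2^n−1 for infinitely many n refutes X.
sources: LandsbergRessayre2017, Grenet2011, AlperBogartVelasco2017, IkenmeyerLandsberg2017
[target] X: for all large n, per_n has an affine determinantal representation of size dc(per_n) with
exact GL×GL-lifts of every two-sided torus substitution x_{kl} ↦ d_k e_l x_{kl} (edc_T(per_n) =
dc(per_n)). -/
@[route_item "route-ValiantsHypothesis-RigidMinimalReps", crux]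
def MinimalRepTorusSymmetric : Prop :=
  ∃ n₀ : ℕ, ∀ n ≥ n₀, Literature.Computability.AlgebraicComplexity.HasEquivariantDetRepr (Subgroup.closure {γ : Matrix.GeneralLinearGroup (Fin n × Fin n) ℂ | ∃ d e : Fin n → ℂ, (∀ i, d i ≠ 0) ∧ (∀ j, e j ≠ 0) ∧ (γ : Matrix (Fin n × Fin n) (Fin n × Fin n) ℂ) = Matrix.diagonal (fun p => d p.1 * e p.2)}) (Literature.Computability.AlgebraicComplexity.perPoly (Fin n) ℂ) (Literature.Computability.AlgebraicComplexity.determinantalComplexity (Literature.Computability.AlgebraicComplexity.perPoly (Fin n) ℂ))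

/-- item stmt-ValiantsHypothesis-5113 · crux · rank 2 · open · by planner
why it might fail: Plain size-minimal finiteness is FALSE (n=3: exact Koszul lines row_0 += ε(x_33·row_5 − x_32·row_4) through Grenet, 45 non-gauge tangent dims); rank-minimisation kills them to 1st order at n=3 only; other affine-preserving polynomial gauge moves or inequivalent optimal ABPs may persist.
sources: HuttenhainIkenmeyer2016, AlperBogartVelasco2017, LandsbergRessayre2017, arXiv:2003.04834
[crux] (card R1, repaired) For all large n, at s = dc(per_n): the affine determinantal
representations A of per_n of size s that minimise the total coefficient rank Σ_{kl} rank(A_{kl})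
are covered by finitely many GL_s × GL_s-orbits A = P·F_i·Q (constant invertible P, Q). [difficulty:
XL] -/
@[route_item "route-ValiantsHypothesis-RigidMinimalReps"]
def DoublyMinimalFinite : Prop :=
  ∃ n₀ : ℕ, ∀ n ≥ n₀, ∀ s : ℕ, Literature.Computability.AlgebraicComplexity.determinantalComplexity (Literature.Computability.AlgebraicComplexity.perPoly (Fin n) ℂ) = s → ∃ (N : ℕ) (F : Fin N → Matrix (Fin s) (Fin s) (MvPolynomial (Fin n × Fin n) ℂ)), ∀ A : Matrix (Fin s) (Fin s) (MvPolynomial (Fin n × Fin n) ℂ), Literature.Computability.AlgebraicComplexity.IsAffineDetRepr (Literature.Computability.AlgebraicComplexity.perPoly (Fin n) ℂ) A → (∀ A' : Matrix (Fin s) (Fin s) (MvPolynomial (Fin n × Fin n) ℂ), Literature.Computability.AlgebraicComplexity.IsAffineDetRepr (Literature.Computability.AlgebraicComplexity.perPoly (Fin n) ℂ) A' → ∑ v : Fin n × Fin n, (A.map (MvPolynomial.coeff (Finsupp.single v 1))).rank ≤ ∑ v : Fin n × Fin n, (A'.map (MvPolynomial.coeff (Finsupp.single v 1))).rank) → ∃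 (i : Fin N) (P Q : Matrix.GeneralLinearGroup (Fin s) ℂ), A = (P : Matrix (Fin s) (Fin s) ℂ).map MvPolynomial.C * F i * (Q : Matrix (Fin s) (Fin s) ℂ).map MvPolynomial.C

/-- item stmt-ValiantsHypothesis-5114 · crux · rank 3 · closed · proved by Summit.ValiantsHypothesis.ValiantsHypothesis.Theorems.RigidMinimalRepsTorusBound.torusBound_proof @ c4a6562f94b5 (prover) · by planner
why it might fail: LR17 Thm 2.8's count uses S_m (k-homogeneity) essentially and no torus-only bound is in print; ONE-sided torus gives only an unordered row-multilinear ABP (bound ~n); the two-sided count needs "levels are sets / no junk paths", resting on regularity (fails at n=2: dc(per_2)=2<3).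
sources: LandsbergRessayre2017, vonzurGathen1987, Grenet2011, IkenmeyerLandsberg2017
[crux] For n ≥ 3, every affine determinantal representation of per_n with exact lifts of the
two-sided torus has size ≥ 2^n − 1 (regularity ⇒ Λ = 0 ⊕ I; generalized eigenspaces of one generic
lifted element (distinct primes) grade rows/columns; matched digraph acyclic; (S,T)-graded ABP; each
level-(S,T) vertex serves only σ with σ(S)=T ⇒ ≥ C(n,d) vertices at depth d). [difficulty: L] -/
@[route_item "route-ValiantsHypothesis-RigidMinimalReps", crux]
def TorusBound : Prop :=
  ∀ n : ℕ, 3 ≤ n → ∀ (m : ℕ) (A : Matrix (Fin m) (Fin m) (MvPolynomial (Fin n × Fin n) ℂ)), Literature.Computability.AlgebraicComplexity.IsEquivariantDetRepr (Subgroup.closure {γ : Matrix.GeneralLinearGroup (Fin n × Fin n) ℂ | ∃ d e : Fin n → ℂ, (∀ i, d i ≠ 0) ∧ (∀ j, e j ≠ 0) ∧ (γ : Matrix (Fin n × Fin n) (Fin n × Fin n) ℂ) = Matrix.diagonal (fun p => d p.1 * e p.2)}) (Literature.Computability.AlgebraicComplexity.perPoly (Fin n) ℂ) A → 2 ^ n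 - 1 ≤ m

/-- item stmt-ValiantsHypothesis-5115 · support · rank 9 · closed · proved by Summit.ValiantsHypothesis.ValiantsHypothesis.Theorems.orbitsForceTorus_proof (prover) · by planner
sources: LandsbergRessayre2017, Borel1991
[support] DoublyMinimalFinite → MinimalRepTorusSymmetric: T acts on doubly-minimal reps by (t⋆A)(x)
= D_t·A(t·x) with D_t = diag((Πd Πe)⁻¹,1,…,1), commuting with the gauge action; it permutes the
finitely many orbits; (ℂ*)^{2n} is divisible so each orbit's stabiliser (finite index) is all of T;
t⋆A = PAQ is exactly an exact lift. Doubly-minimal reps exist (well-ordering on ℕ,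
`hasDetRepr_determinantalComplexity_holds`). [difficulty: provable-now] -/
@[route_item "route-ValiantsHypothesis-RigidMinimalReps"]
def OrbitsForceTorus : Prop :=
  DoublyMinimalFinite → MinimalRepTorusSymmetric

/-- item stmt-ValiantsHypothesis-5116 · support · rank 9 · closed · proved by Summit.ValiantsHypothesis.Theorems.expDcGlue_proof @ 7eb6c53fa9c7 (prover) · by planner
sources: Burgisser2000, Valiant1979, LandsbergRessayre2017
[support] an eventual exponential lower bound c^n ≤ dc(per_n) (c > 1) implies VH: VP = VNP ⇒ per ∈
VP (perFamily_mem_VNP_holds, mem_VP_ofFintype_iff_holds) ⇒ dc(per_n) ≤ 2^((log n + a)^a)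
(isQPBounded_determinantalComplexity_of_isVPFamily_holds) = o(c^n), contradiction; all ingredients
proved in tree (Hub: Theorems/HubHub.lean). The hypothesis is verbatim route GrenetRigidity's target
DcPerExponential, so this item = GrenetRigidity.Assembly unfolded: prove once, `exact` twice.
[difficulty: provable-now] -/
@[route_item "route-ValiantsHypothesis-RigidMinimalReps", crux]
def ExpDcGlue : Prop :=
  (∃ c : ℝ, 1 < c ∧ ∃ n₀ : ℕ, ∀ n ≥ n₀, c ^ n ≤ (Literature.Computability.AlgebraicComplexity.determinantalComplexity (Literature.Computability.AlgebraicComplexity.perPoly (Fin n) ℂ) : ℝ)) → ValiantsHypothesis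

/-- item stmt-ValiantsHypothesis-5117 · assembly · rank 1 · closed · proved by Summit.ValiantsHypothesis.Theorems.RigidMinimalReps.assembly_proof @ 3de250ba37b9 (prover) · by planner
sources: LandsbergRessayre2017, Burgisser2000, Valiant1979
[assembly] MinimalRepTorusSymmetric → TorusBound → ValiantsHypothesis (via the ExpDcGlue argument). -/
@[route_item "route-ValiantsHypothesis-RigidMinimalReps"]
def Assembly : Prop :=
  MinimalRepTorusSymmetric → TorusBound → ValiantsHypothesis

/-! D-0027 §2.1 — DECIDING THEOREM (planner-authored via `route open/edit --closes-file`; by planner-rbadge-ValiantsHypothesis-RigidMinimal-4f8df0f8-g2-0 2026-08-15T16:23:20Z):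
its hypotheses are this route's items and its conclusion the sub-problem Statement (glue_lint), and it elaborates with this file. -/

@[closes "route-ValiantsHypothesis-RigidMinimalReps"] theorem closes (h_MinimalRepTorusSymmetric : MinimalRepTorusSymmetric) (h_TorusBound : TorusBound) :
    _root_.ValiantsHypothesis := by
  classical
  -- (1) X + TorusBound: the eventual lower bound `2 ^ n - 1 ≤ dc(per_n)` for `n ≥ max n₀ 3`.
  obtain ⟨n₀, hn₀⟩ := h_MinimalRepTorusSymmetric
  have hdc : ∀ n : ℕ, n₀ ≤ n → 3 ≤ n →
      2 ^ n - 1 ≤ Literature.Computability.AlgebraicComplexity.determinantalComplexity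
        (Literature.Computability.AlgebraicComplexity.perPoly (Fin n) ℂ) := by
    intro n hn h3
    obtain ⟨A, hA⟩ := hn₀ n hn
    exact h_TorusBound n h3 _ A hA
  -- (2) `VP ℂ = VNP ℂ` would put the permanent family in `VP` (Valiant: `per ∈ VNP`, bundling bridge),
  --     hence make `dc(per_n)` quasi-polynomially bounded (VP ⊆ VQP = qp-projections of det; all proved in tree).
  show Literature.Computability.AlgebraicComplexity.VP ℂ ≠ Literature.Computability.AlgebraicComplexity.VNP ℂ
  intro hEq
  have hVNP := Literature.Computability.AlgebraicComplexity.perFamily_mem_VNP_holds ℂ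
  have hVP : Literature.Computability.AlgebraicComplexity.perFamily ℂ ∈
      Literature.Computability.AlgebraicComplexity.VP ℂ := by rw [hEq]; exact hVNP
  have hper : Literature.Computability.AlgebraicComplexity.IsVPFamily
      (fun n => Literature.Computability.AlgebraicComplexity.perPoly (Fin n) ℂ) :=
    (Literature.Computability.AlgebraicComplexity.mem_VP_ofFintype_iff_holds _).1 hVP
  obtain ⟨c, hc⟩ :=
    Literature.Computability.AlgebraicComplexity.isQPBounded_determinantalComplexity_of_isVPFamily_holds
      (fun n => Literature.Computability.AlgebraicComplexity.perPoly (Fin n) ℂ) hper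
  -- (3) Arithmetic: at `n = 2 ^ m`, `m = 2 ^ j`, `j = n₀ + 2c + 8` the quasi-polynomial bound
  --     `2 ^ ((log₂ n + c) ^ c)` is `< 2 ^ n - 1`, contradicting (1).
  have hsq : ∀ t : ℕ, t * t ≤ 2 * 2 ^ t := by
    intro t
    induction t with
    | zero => norm_num
    | succ t ih =>
      have h1 : t < 2 ^ t := Nat.lt_two_pow_self
      rw [pow_succ]
      nlinarith [h1, ih]
  obtain ⟨j, hj⟩ : ∃ j : ℕ, j = n₀ + 2 * c + 8 := ⟨_, rfl⟩
  obtain ⟨m, hm⟩ : ∃ m : ℕ, m = 2 ^ j := ⟨_, rfl⟩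
  obtain ⟨n, hn⟩ : ∃ n : ℕ, n = 2 ^ m := ⟨_, rfl⟩
  have hjm : j < m := by rw [hm]; exact Nat.lt_two_pow_self
  have hmn : m < n := by rw [hn]; exact Nat.lt_two_pow_self
  have hlog : Nat.log 2 n = m := by rw [hn]; exact Nat.log_pow (by norm_num) m
  have hc8 : 2 * c + 8 ≤ j := by omega
  -- linear-in-`j` versus `2 ^ j`
  have hlin : (j + 1) * c + 2 ≤ m := by
    have h1 := hsq j
    have h2 : (2 * c + 8) * (j + 1) ≤ j * (j + 1) := Nat.mul_le_mul_right (j + 1) hc8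
    rw [hm]
    nlinarith [h1, h2]
  -- `(m + c) ^ c ≤ (2m) ^ c = 2 ^ ((j + 1) c)`
  have hpow : (m + c) ^ c ≤ 2 ^ ((j + 1) * c) := by
    calc (m + c) ^ c ≤ (2 * m) ^ c := Nat.pow_le_pow_left (by omega) c
      _ = 2 ^ ((j + 1) * c) := by rw [hm, ← pow_succ', ← pow_mul]
  have hE : (m + c) ^ c + 2 ≤ n := by
    have h4 : 2 ^ ((j + 1) * c + 2) ≤ 2 ^ m := Nat.pow_le_pow_right (by norm_num) hlin
    rw [pow_add] at h4
    norm_num at h4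
    have h1 : 1 ≤ 2 ^ ((j + 1) * c) := Nat.one_le_two_pow
    rw [hn]
    omega
  -- the two bounds on `dc(per_n)` collide
  have hlow := hdc n (by omega) (by omega)
  have hup : Literature.Computability.AlgebraicComplexity.determinantalComplexity
      (Literature.Computability.AlgebraicComplexity.perPoly (Fin n) ℂ) ≤ 2 ^ ((m + c) ^ c) := by
    have := hc n
    simp only at this
    rwa [hlog] at this
  have h4 : 2 ^ ((m + c) ^ c + 2) ≤ 2 ^ n := Nat.pow_le_pow_right (by norm_num) hE
  rw [pow_add] at h4
  norm_num at h4
  have h1 : 1 ≤ 2 ^ ((m + c) ^ c) := Nat.one_le_two_pow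
  omega

end Summit.ValiantsHypothesis.ValiantsHypothesis.Theses.RigidMinimalReps
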